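import Summits.Ventures.AbcSig.Rows.StatementsC1b
import Summits.Ventures.AbcSig.Rows.XnYn53Z2OddX

/-!
# Venture AbcSig — CELL bridge for `xⁿ + yⁿ = 53 z²` (`xy` odd; ε₄-part of the level): p1's census predicate `Rows.C1CellOdd 53 7 ∅`

HONEST FRAMING. COMPUTATION cell `pub-abcsig`; CONDITIONAL theorem; no claim on ABC or any summit. Hypotheses exactly
those of `Rows/XnYn53Z2OddX.lean` (`xrow_XnYn53Z2Odd`): `BS04Package` (CITED), the ε₄-part predicate `InEps4` with `ArisesInPart` (CITED, M10-ε₄) universally quantified in the exponent and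
`DataCompleteOn` / `RefinesCPSymAll` (COMPUTED, installed ε₄ pair of `census/levels-eps4/`; norm-form certificates `Sieve/CharpolyCert.lean`), and the row's per-orbit CITED exclusions
`hX_…` universally quantified in the exponent. Conclusion = p1's statement of the SIGNED row of record
`census/rows/C1/C1-C53-odd.md` (sha16 `e3425e1fc47de89a`) in the census vocabulary
(`Rows/Statements.lean`, `Rows/StatementsC1b.lean`). GENERATED by p-lean g4 `gen4/cprow.py` (pattern of `Rows/XnYn14Z2XCell.lean`).
-/

namespace Summit.Ventures.AbcSig

/-- `xⁿ + yⁿ = 53 z²` (`xy` odd; ε₄-part of the level): p1's `Rows.C1CellOdd 53 7 ∅` from `xrow_XnYn53Z2Odd` (hypotheses as there, `hX_…` for every exponent). -/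
theorem C1CellOdd_53_of (M : NewformModel) (hP : M.BS04Package)
    (InEps4 : M.Form 89888 → Prop) (hD89888 : M.DataCompleteOn 89888 InEps4 level89888E4Orbits)
    (hCP89888 : M.RefinesCPSymAll 89888 level89888E4CP)
    (hM10 : ∀ n : ℕ, M.ArisesInPart 89888 InEps4 (fun S => S.A = 1 ∧ S.B = 1 ∧ S.C = 53 ∧ S.n = n ∧ ¬ 2 ∣ S.a * S.b))
    (hX_orbit_89888E4_1 : ∀ n : ℕ, M.Excludes 89888 orbit_89888E4_1 (fun S => S.A = 1 ∧ S.B = 1 ∧ S.C = 53 ∧ S.n = n ∧ ¬ 2 ∣ S.a * S.b))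
    (hX_orbit_89888E4_2 : ∀ n : ℕ, M.Excludes 89888 orbit_89888E4_2 (fun S => S.A = 1 ∧ S.B = 1 ∧ S.C = 53 ∧ S.n = n ∧ ¬ 2 ∣ S.a * S.b))
    (hX_orbit_89888E4_6 : ∀ n : ℕ, n ∈ ([7, 13] : List ℕ) → M.Excludes 89888 orbit_89888E4_6 (fun S => S.A = 1 ∧ S.B = 1 ∧ S.C = 53 ∧ S.n = n ∧ ¬ 2 ∣ S.a * S.b))
    (hX_orbit_89888E4_7 : ∀ n : ℕ, n ∈ ([7, 13] : List ℕ) → M.Excludes 89888 orbit_89888E4_7 (fun S => S.A = 1 ∧ S.B = 1 ∧ S.C = 53 ∧ S.n = n ∧ ¬ 2 ∣ S.a * S.b))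
    (hX_orbit_89888E4_9 : ∀ n : ℕ, n ∈ ([41] : List ℕ) → M.Excludes 89888 orbit_89888E4_9 (fun S => S.A = 1 ∧ S.B = 1 ∧ S.C = 53 ∧ S.n = n ∧ ¬ 2 ∣ S.a * S.b))
    (hX_orbit_89888E4_10 : ∀ n : ℕ, n ∈ ([41] : List ℕ) → M.Excludes 89888 orbit_89888E4_10 (fun S => S.A = 1 ∧ S.B = 1 ∧ S.C = 53 ∧ S.n = n ∧ ¬ 2 ∣ S.a * S.b)) :
    Rows.C1CellOdd 53 7 ∅ := by
  intro n hn h11 hC _ x y z hpar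
  exact xrow_XnYn53Z2Odd M hP InEps4 hD89888 hCP89888 n hn h11  hC (hM10 n) (hX_orbit_89888E4_1 n) (hX_orbit_89888E4_2 n) (hX_orbit_89888E4_6 n) (hX_orbit_89888E4_7 n) (hX_orbit_89888E4_9 n) (hX_orbit_89888E4_10 n) x y z hpar

end Summit.Ventures.AbcSig
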